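import Summits.QuantumFields.BalabanUV.Gaps.EndDrawdownLinearThresholdLower

/-!
# Gaps / EndDrawdownLinearThresholdCritical — THE THRESHOLD ITSELF IS IMPOSSIBLE: `¬ EndPossibleLin bOct cStarConj γ₀`

X18 (`EndDrawdownLinearThresholdLower`) proved `¬ EndPossibleLin bOct C γ₀` for `0 < C < cStarConj = √(84∕(77 + 72·log 2))` by feeding GEN 11's
`8^m`-piece NECESSITY CRITERION (`EndDrawdownLinearThresholdRenormFine.not_endPossibleLin_bOct_of_prefixed`: a PRE-FIXED point `σ ≤ S_m C σ`,
`σ ≥ C²`, of the `8^m`-piece Euler block map makes every barrier above `σ·4^m` unbounded) — and X19 proves possibility for `C > cStarConj`.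
AT the constant neither fixed-resolution criterion can fire: the doubling time `C²·ψ` is `≥ 7` everywhere with equality only at the tangency
`x = 7∕3` (X16), and every explicit Euler block falls strictly SHORT of the flow (the speed `1 − C∕√w` increases along the motion), so
`S_m C σ < σ` for every `m` and every `σ ≥ C²`.  THIS FILE decides the critical value all the same:
**`not_endPossibleLin_bOct_of_le_cStarConj`: for every `0 < C ≤ cStarConj` and every box `γ₀ > 0`, `¬ EndPossibleLin bOct C γ₀`** — in
particular **`not_endPossibleLin_bOct_cStarConj`** — so GEN 10's threshold `C⋆(bOct)` is NOT attained from the possible side.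
MECHANISM (monotone comparisons only; no limits, no Gronwall, no differentiability of any flow, no parabolic fixed-point asymptotics):
(1) a CHAIN version of the necessity criterion at FULL resolution — block `t` of the octal staircase IS `8^t` explicit Euler pieces of scaled
duration `7∕8^t`, and X12's growth lemma `barrier_block_growth_fine` holds with `m = t`: if levels `σ_n ≥ C²` satisfy
`σ_{n+1} ≤ S_{t₀+n} C σ_n` for all `n`, every barrier above `σ_0·4^{t₀}` keeps scaled height `≥ σ_n ≥ C²` and is unbounded
(**`no_barrier_bOct_of_chain`**, **`not_endPossibleLin_bOct_of_chain`**); (2) the local quadratic bound **`psi_sub_psiMin_le`**: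
`ψ(x) − ψ(7∕3) ≤ 12·(x − 7∕3)²` on `[7∕3, 8∕3]` (X16's `hasDerivAt_psi`; `x ↦ ψ(x) − 12(x − 7∕3)²` is non-increasing there); (3) ONE LINK
(**`chain_link`**): with `w = C(7∕3 + s)`, `w′ = C(7∕3 + s′)`, `0 ≤ s′ ≤ s ≤ 1∕3`, if a point `x ≥ (w∕2)²` is reached from `w∕2` in flow time
`≥ 7 − ε` and the BUDGET inequality `12C²s² + ε ≤ (14∕3)·C²·(s − s′)` holds, then `w′² ≤ x` — because `T(w) − T(w∕2) = C²ψ(7∕3 + s) ≤ 7 + 12C²s²`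
(X16 `flowTime_sub_half`, `C²ψ(7∕3) ≤ 7` for `C ≤ cStarConj`) while `T(w) − T(w′) ≥ w² − w′² ≥ (14∕3)C²(s − s′)` (X18 `flowTime_sub_ge`);
(4) the explicit slowly-closing gap `s_n = 7∕(36(n+2))` has budget `(14∕3)C²(s_n − s_{n+1}) − 12C²s_n² = (49∕108)·C²·(n+1)∕((n+2)²(n+3))
≥ 49C²∕(1296·8^n)` (**`chain_budget_eq`**, **`cube_le_twelve_mul_pow`**), which absorbs the Euler deficit `49λ_n∕8^{t₀+n} ≤ (108∕7)∕(C²·8^{t₀+n})`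
of X18's `flowTime_iterate_ge` (`λ_n = C∕(2v_n³) ≤ 108∕(343C²)` as `v_n ≥ 7C∕6`, **`lam_le`**) as soon as `8^{t₀} ≥ 139968∕(343·C⁴)`
(**`chain_holds`**).  Hence the levels `σ_n = (C(7∕3 + s_n)∕2)²` form a chain from block `t₀` on, and the criterion (1) fires at `C ≤ cStarConj`.

WHAT IS NOT CLAIMED: possibility above the constant (X19, staged); anything about Bałaban's table.  (cell pub-balaban-gaps, seat g1-p3 GEN 12,
rows CAP ∕ tail «split ∕ weakening»; own leaf; file 37 of «the one-loop interface of the END statement»; imports X18 only.)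

HONEST FRAMING (cell rule, page 1 of everything): [folklore] one-variable calculus (a monotone comparison between an explicit Euler scheme and the
time function of a scalar ODE, plus one explicit slowly decreasing sequence) fed to a kernel-checked necessity criterion for ONE toy sequence;
`EndPossibleLin` is a quantified READING of the cell's END-grade statement over Bałaban-free data `(b, C, γ₀)`; 0 binders of Bałaban's discharged;
0 coefficients certified; words ∕ odds of rows CAP ∕ tail ∕ (D4) ∕ (D1) UNCHANGED; one finite T⁴; NOT [I] Thm 2, NOT `BetaPertH`, NOT the
continuum limit, NOT Clay.
-/

namespace Summit.QuantumFields.BalabanUV.Gaps.EndDrawdownLinearThresholdCritical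

open Real Set
open Summit.QuantumFields.BalabanUV.Gaps.EndDrawdownLinearRoad (EndPossibleLin)
open Summit.QuantumFields.BalabanUV.Gaps.EndDrawdownLinearBarrier (IsBarrier not_endPossibleLin_iff_noBarrier)
open Summit.QuantumFields.BalabanUV.Gaps.EndDrawdownLinearThreshold (bOct bs8)
open Summit.QuantumFields.BalabanUV.Gaps.EndDrawdownLinearThresholdRenormFine (tau eStep S tau_pos le_iterate_eStep S_mono
  barrier_block_growth_fine)
open Summit.QuantumFields.BalabanUV.Gaps.EndDrawdownLinearThresholdConstant
open Summit.QuantumFields.BalabanUV.Gaps.EndDrawdownLinearThresholdLower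

noncomputable section

/-! ## §1 The necessity criterion along a CHAIN of levels at full resolution -/

/-- **NO BARRIER ABOVE A CHAIN** · if levels `σ_n ≥ C²` satisfy `σ_{n+1} ≤ S_{t₀+n} C σ_n` (the `8^{t₀+n}`-piece Euler block map of block `t₀ + n`,
i.e. the block's own unit steps), then every barrier for `(bOct, C)` above the level `σ_0·4^{t₀}` has scaled height `κ_{t₀+n} ≥ σ_n` for all `n`
(induction with X12's `barrier_block_growth_fine` at `m = t`: `κ_{t+1} ≥ S_t(κ_t) ≥ S_t(σ_n) ≥ σ_{n+1}`), hence height `≥ C²·4^{t₀+n}` — unbounded,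
contradiction. [folklore] -/
theorem no_barrier_bOct_of_chain {C : ℝ} (hC : 0 < C) (t₀ : ℕ) {σ : ℕ → ℝ} (hσ : ∀ n, C ^ 2 ≤ σ n)
    (hchain : ∀ n, σ (n + 1) ≤ S (t₀ + n) C (σ n)) {A Y : ℝ} {ℓ : ℕ → ℝ} (hA : σ 0 * 4 ^ t₀ ≤ A) :
    ¬ IsBarrier bOct C A Y ℓ := by
  intro hℓ
  have hgrow : ∀ n : ℕ, σ n * 4 ^ (t₀ + n) ≤ ℓ (bs8 (t₀ + n)) := by
    intro n
    induction n with
    | zero => simpa using hA.trans (hℓ.1 _)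
    | succ n ih =>
      have h4 : (0 : ℝ) < 4 ^ (t₀ + n) := by positivity
      have hκ : C ^ 2 * 4 ^ (t₀ + n) ≤ ℓ (bs8 (t₀ + n)) := le_trans (mul_le_mul_of_nonneg_right (hσ n) h4.le) ih
      have hb := barrier_block_growth_fine hC hℓ (le_refl (t₀ + n)) hκ
      have hS : σ (n + 1) ≤ S (t₀ + n) C (ℓ (bs8 (t₀ + n)) / 4 ^ (t₀ + n)) :=
        (hchain n).trans (S_mono hC (t₀ + n) (hσ n) ((le_div_iff₀ h4).mpr ih))
      rw [show t₀ + (n + 1) = t₀ + n + 1 by omega]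
      have h4' : (0 : ℝ) ≤ 4 ^ (t₀ + n + 1) := by positivity
      exact (mul_le_mul_of_nonneg_right hS h4').trans hb
  have hC2 : 0 < C ^ 2 := by positivity
  obtain ⟨n, hn⟩ := pow_unbounded_of_one_lt (Y / (C ^ 2 * 4 ^ t₀)) (by norm_num : (1 : ℝ) < 4)
  have hY := (hgrow n).trans (hℓ.2.1 _)
  rw [div_lt_iff₀ (by positivity)] at hn
  have e : C ^ 2 * 4 ^ (t₀ + n) = 4 ^ n * (C ^ 2 * 4 ^ t₀) := by rw [pow_add]; ring
  have hσn := mul_le_mul_of_nonneg_right (hσ n) (show (0 : ℝ) ≤ 4 ^ (t₀ + n) by positivity)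
  linarith

/-- **IMPOSSIBILITY FROM A CHAIN** · `C > 0`, levels `σ_n ≥ C²` with `σ_{n+1} ≤ S_{t₀+n} C σ_n` for all `n` ⟹ `¬ EndPossibleLin bOct C γ₀` (every box).
The constant chain `σ_n = σ` from `t₀ = m` is NOT a special case (`S_t ≤ S_m` for `t ≥ m` goes the wrong way) — both are instances of the barrier
criterion `EndDrawdownLinearBarrier.not_endPossibleLin_iff_noBarrier`. [cite: Balaban1987RG1, Thm 2 p.259 (first sentence) and (2.12)–(2.14) p.268] -/
theorem not_endPossibleLin_bOct_of_chain {C : ℝ} (hC : 0 < C) (t₀ : ℕ) {σ : ℕ → ℝ} (hσ : ∀ n, C ^ 2 ≤ σ n)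
    (hchain : ∀ n, σ (n + 1) ≤ S (t₀ + n) C (σ n)) {γ₀ : ℝ} (hγ₀ : 0 < γ₀) : ¬ EndPossibleLin bOct C γ₀ :=
  (not_endPossibleLin_iff_noBarrier hC.le hγ₀).mpr
    ⟨σ 0 * 4 ^ t₀, by have := lt_of_lt_of_le (by positivity : (0 : ℝ) < C ^ 2) (hσ 0); positivity,
      fun _ _ => no_barrier_bOct_of_chain hC t₀ hσ hchain le_rfl⟩

/-! ## §2 The local quadratic bound for the profile above its minimum -/

/-- **`ψ(x) − ψ(7∕3) ≤ 12·(x − 7∕3)²` on `[7∕3, 8∕3]`** · `x ↦ ψ(x) − 12(x − 7∕3)²` is non-increasing there: its derivative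
`3x∕2 + 1 − 2∕((x−1)(x−2)) − 24(x − 7∕3)` has the sign of `−(3x − 7)(15x² − 48x + 32) ≤ 0`. [folklore] -/
theorem psi_sub_psiMin_le {x : ℝ} (hx : 7 / 3 ≤ x) (hx' : x ≤ 8 / 3) : psi x - psi (7 / 3) ≤ 12 * (x - 7 / 3) ^ 2 := by
  have hD : ∀ u ∈ Icc (7 / 3 : ℝ) (8 / 3), HasDerivAt (fun u : ℝ => psi u - 12 * (u - 7 / 3) ^ 2)
      (3 / 2 * u + 1 - 2 / ((u - 1) * (u - 2)) - 12 * (2 * (u - 7 / 3))) u := by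
    intro u hu
    have hu2 : 2 < u := by linarith [hu.1]
    have h2 : HasDerivAt (fun u : ℝ => 12 * (u - 7 / 3) ^ 2) (12 * (2 * (u - 7 / 3))) u := by
      have h := ((hasDerivAt_id u).sub_const (7 / 3 : ℝ)).pow 2
      simpa using h.const_mul 12
    exact (hasDerivAt_psi hu2).sub h2
  have hanti : AntitoneOn (fun u : ℝ => psi u - 12 * (u - 7 / 3) ^ 2) (Icc (7 / 3) (8 / 3)) := by
    refine antitoneOn_of_hasDerivWithinAt_nonpos (convex_Icc _ _) (fun u hu => (hD u hu).continuousAt.continuousWithinAt)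
      (fun u hu => (hD u (interior_subset hu)).hasDerivWithinAt) fun u hu => ?_
    rw [interior_Icc] at hu
    have hu1 : 0 < u - 1 := by linarith [hu.1]
    have hu2 : 0 < u - 2 := by linarith [hu.1]
    have hprod : 0 < (u - 1) * (u - 2) := mul_pos hu1 hu2
    -- `2 − (3u∕2 + 1 − 24(u − 7∕3))·(u−1)(u−2) = (3u − 7)(15u² − 48u + 32)∕2 ≥ 0`
    have key : (3 / 2 * u + 1 - 12 * (2 * (u - 7 / 3))) * ((u - 1) * (u - 2)) ≤ 2 := by
      have hA : 0 ≤ 3 * u - 7 := by linarith [hu.1]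
      have hB : 0 ≤ 15 * u ^ 2 - 48 * u + 32 := by nlinarith [sq_nonneg (u - 7 / 3), hu.1]
      nlinarith [mul_nonneg hA hB]
    have h := (le_div_iff₀ hprod).mpr key
    linarith
  have h := hanti ⟨le_rfl, by norm_num⟩ ⟨hx, hx'⟩ hx
  simp only at h
  linarith

/-! ## §3 One link of the chain -/

/-- **ONE LINK** · `0 < C` with `C²ψ(7∕3) ≤ 7` (i.e. `C ≤ cStarConj`), `0 ≤ s′ ≤ s ≤ 1∕3`, `w = C(7∕3 + s)`, `w′ = C(7∕3 + s′)`: if `x ≥ (w∕2)²` is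
reached from `w∕2` in flow time `≥ 7 − ε` and the budget inequality `12C²s² + ε ≤ (14∕3)C²(s − s′)` holds, then `w′² ≤ x` — since
`T(w) − T(w∕2) = C²ψ(7∕3 + s) ≤ 7 + 12C²s²` and `T(w) − T(w′) ≥ w² − w′² ≥ (14∕3)C²(s − s′)`, so `T(w′) ≤ T(w∕2) + 7 − ε ≤ T(√x)`. [folklore] -/
theorem chain_link {C s s' ε x : ℝ} (hC : 0 < C) (hCψ : C ^ 2 * psi (7 / 3) ≤ 7) (hs' : 0 ≤ s') (hss' : s' ≤ s)
    (hs : s ≤ 1 / 3) (hx : (C * (7 / 3 + s) / 2) ^ 2 ≤ x)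
    (htime : 7 - ε ≤ flowTime C (Real.sqrt x) - flowTime C (C * (7 / 3 + s) / 2))
    (hε : 12 * C ^ 2 * s ^ 2 + ε ≤ 14 / 3 * C ^ 2 * (s - s')) :
    (C * (7 / 3 + s')) ^ 2 ≤ x := by
  set w := C * (7 / 3 + s) with hw
  set w' := C * (7 / 3 + s') with hw'
  have hC2 : 0 < C ^ 2 := by positivity
  have hw2C : 2 * C < w := by rw [hw]; nlinarith
  have hw'C : C < w' := by rw [hw']; nlinarith
  have hww' : w' ≤ w := by rw [hw, hw']; nlinarith
  -- (P1) the doubling time from `w∕2`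
  have hP1 : flowTime C w - flowTime C (w / 2) ≤ 7 + 12 * C ^ 2 * s ^ 2 := by
    rw [flowTime_sub_half hC hw2C]
    have hwC : w / C = 7 / 3 + s := by rw [hw]; field_simp
    rw [hwC]
    have hψ := psi_sub_psiMin_le (x := 7 / 3 + s) (by linarith) (by linarith)
    have e : (7 / 3 + s - 7 / 3 : ℝ) = s := by ring
    rw [e] at hψ
    nlinarith [mul_le_mul_of_nonneg_left hψ hC2.le]
  -- (P2) the time from `w′` up to `w`
  have hP2 : 14 / 3 * C ^ 2 * (s - s') ≤ flowTime C w - flowTime C w' := by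
    have h := flowTime_sub_ge hC hw'C hww'
    have hk : 1 ≤ w / (w - C) := by rw [le_div_iff₀ (by linarith)]; linarith
    have hD : 0 ≤ w ^ 2 - w' ^ 2 := by nlinarith
    have h1 : w ^ 2 - w' ^ 2 ≤ (w ^ 2 - w' ^ 2) * (w / (w - C)) := le_mul_of_one_le_right hD hk
    have h2 : 14 / 3 * C ^ 2 * (s - s') ≤ w ^ 2 - w' ^ 2 := by
      have e : w ^ 2 - w' ^ 2 = C ^ 2 * ((s - s') * (14 / 3 + s + s')) := by rw [hw, hw']; ring
      rw [e]
      nlinarith [mul_nonneg (sub_nonneg.mpr hss') (add_nonneg hs' (hs'.trans hss')), hC2]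
    linarith
  -- so `T(w′) ≤ T(√x)`
  have hwhalf : w / 2 = C * (7 / 3 + s) / 2 := by rw [hw]
  rw [← hwhalf] at htime hx
  have hT : flowTime C w' ≤ flowTime C (Real.sqrt x) := by linarith
  have hx0 : 0 ≤ x := le_trans (sq_nonneg _) hx
  have hsx : w / 2 ≤ Real.sqrt x := (Real.le_sqrt (by linarith) hx0).mpr hx
  have hsxC : C < Real.sqrt x := lt_of_lt_of_le (by linarith) hsx
  have hle : w' ≤ Real.sqrt x := ((flowTime_strictMonoOn hC).le_iff_le hw'C hsxC).mp hT
  have h0w' : 0 ≤ w' := by linarith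
  calc w' ^ 2 ≤ Real.sqrt x ^ 2 := pow_le_pow_left₀ h0w' hle 2
    _ = x := Real.sq_sqrt hx0

/-! ## §4 The explicit chain `s_n = 7∕(36(n+2))` and its budget -/

/-- Polynomial versus geometric growth: `(n+2)²(n+3) ≤ 12·8^n`. [folklore] -/
theorem cube_le_twelve_mul_pow (n : ℕ) : ((n : ℝ) + 2) ^ 2 * ((n : ℝ) + 3) ≤ 12 * 8 ^ n := by
  induction n with
  | zero => norm_num
  | succ n ih =>
    push_cast
    have h8 : (0 : ℝ) ≤ 8 ^ n := by positivity
    have hn : (0 : ℝ) ≤ n := n.cast_nonneg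
    have step : ((n : ℝ) + 1 + 2) ^ 2 * ((n : ℝ) + 1 + 3) ≤ 8 * (((n : ℝ) + 2) ^ 2 * ((n : ℝ) + 3)) := by
      nlinarith [mul_nonneg hn hn, mul_nonneg (mul_nonneg hn hn) hn]
    rw [show (8 : ℝ) ^ (n + 1) = 8 ^ n * 8 from pow_succ 8 n]
    nlinarith [ih, step]

/-- THE BUDGET IDENTITY of the chain `s_n = 7∕(36(n+2))`:
`(14∕3)C²(s_n − s_{n+1}) − 12C²s_n² = (49∕108)·C²·(n+1)∕((n+2)²(n+3))`. [folklore] -/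
theorem chain_budget_eq (C : ℝ) (n : ℕ) :
    14 / 3 * C ^ 2 * (7 / (36 * ((n : ℝ) + 2)) - 7 / (36 * ((n : ℝ) + 3))) - 12 * C ^ 2 * (7 / (36 * ((n : ℝ) + 2))) ^ 2 =
      49 / 108 * C ^ 2 * (((n : ℝ) + 1) / (((n : ℝ) + 2) ^ 2 * ((n : ℝ) + 3))) := by
  have h2 : (n : ℝ) + 2 ≠ 0 := by positivity
  have h3 : (n : ℝ) + 3 ≠ 0 := by positivity
  field_simp
  ring

/-- THE BUDGET BOUND: `(14∕3)C²(s_n − s_{n+1}) − 12C²s_n² ≥ 49C²∕(1296·8^n)`. [folklore] -/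
theorem chain_budget_ge (C : ℝ) (n : ℕ) :
    49 * C ^ 2 / (1296 * 8 ^ n) ≤
      14 / 3 * C ^ 2 * (7 / (36 * ((n : ℝ) + 2)) - 7 / (36 * ((n : ℝ) + 3))) - 12 * C ^ 2 * (7 / (36 * ((n : ℝ) + 2))) ^ 2 := by
  rw [chain_budget_eq]
  have hC2 : 0 ≤ C ^ 2 := sq_nonneg C
  have hcube := cube_le_twelve_mul_pow n
  have hpos : (0 : ℝ) < ((n : ℝ) + 2) ^ 2 * ((n : ℝ) + 3) := by positivity
  have h8 : (0 : ℝ) < 8 ^ n := by positivity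
  have hfrac : 1 / (12 * (8 : ℝ) ^ n) ≤ ((n : ℝ) + 1) / (((n : ℝ) + 2) ^ 2 * ((n : ℝ) + 3)) := by
    rw [div_le_div_iff₀ (by positivity) hpos]
    have hn : (0 : ℝ) ≤ n := n.cast_nonneg
    nlinarith
  calc 49 * C ^ 2 / (1296 * 8 ^ n) = 49 / 108 * C ^ 2 * (1 / (12 * 8 ^ n)) := by field_simp; ring
    _ ≤ 49 / 108 * C ^ 2 * (((n : ℝ) + 1) / (((n : ℝ) + 2) ^ 2 * ((n : ℝ) + 3))) :=
      mul_le_mul_of_nonneg_left hfrac (by positivity)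

/-- The Euler deficit coefficient of X18's `flowTime_iterate_ge` along the chain: `λ = C∕(2v³) ≤ 108∕(343C²)` for `v ≥ 7C∕6`. [folklore] -/
theorem lam_le {C v : ℝ} (hC : 0 < C) (hv : 7 * C / 6 ≤ v) : C / (2 * v ^ 3) ≤ 108 / (343 * C ^ 2) := by
  have hv0 : 0 < v := lt_of_lt_of_le (by positivity) hv
  rw [div_le_div_iff₀ (by positivity) (by positivity)]
  have h3 : (7 * C / 6) ^ 3 ≤ v ^ 3 := pow_le_pow_left₀ (by positivity) hv 3
  nlinarith [h3, hC]

/-- **THE CHAIN HOLDS** · `0 < C`, `C²ψ(7∕3) ≤ 7`, `8^{t₀} ≥ 139968∕(343C⁴)`: the levels `σ_n = (C(7∕3 + s_n)∕2)²`, `s_n = 7∕(36(n+2))`, satisfy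
`σ_{n+1} ≤ S_{t₀+n} C σ_n` for every `n` (X18 `flowTime_iterate_ge` supplies flow time `≥ 7 − 49λ_n∕8^{t₀+n}` for the `8^{t₀+n}` Euler pieces from
`σ_n`; `chain_budget_ge` and `lam_le` make `chain_link` applicable). [folklore] -/
theorem chain_holds {C : ℝ} (hC : 0 < C) (hCψ : C ^ 2 * psi (7 / 3) ≤ 7) {t₀ : ℕ}
    (ht₀ : 139968 / (343 * C ^ 4) ≤ (8 : ℝ) ^ t₀) (n : ℕ) :
    (C * (7 / 3 + 7 / (36 * (((n + 1 : ℕ) : ℝ) + 2))) / 2) ^ 2 ≤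
      S (t₀ + n) C ((C * (7 / 3 + 7 / (36 * ((n : ℝ) + 2))) / 2) ^ 2) := by
  set s : ℝ := 7 / (36 * ((n : ℝ) + 2)) with hsdef
  set s' : ℝ := 7 / (36 * ((n : ℝ) + 3)) with hs'def
  have hcast : (7 : ℝ) / (36 * (((n + 1 : ℕ) : ℝ) + 2)) = s' := by rw [hs'def]; push_cast; ring
  rw [hcast]
  have hn : (0 : ℝ) ≤ n := n.cast_nonneg
  have hs0 : 0 < s := by rw [hsdef]; positivity
  have hs'0 : 0 ≤ s' := by rw [hs'def]; positivity
  have hss' : s' ≤ s := by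
    rw [hsdef, hs'def]; exact div_le_div_of_nonneg_left (by norm_num) (by positivity) (by nlinarith)
  have hs3 : s ≤ 1 / 3 := by rw [hsdef, div_le_iff₀ (by positivity)]; nlinarith
  set v₀ : ℝ := C * (7 / 3 + s) / 2 with hv₀def
  have hv₀ge : 7 * C / 6 ≤ v₀ := by rw [hv₀def]; nlinarith
  have hv₀C : C < v₀ := lt_of_lt_of_le (by linarith) hv₀ge
  have hv₀0 : 0 < v₀ := lt_trans hC hv₀C
  set t := t₀ + n with htdef
  set lam := C / (2 * v₀ ^ 3) with hlam
  have hlam0 : 0 ≤ lam := by positivity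
  -- flow time of the `8^t` Euler pieces from `σ_n = v₀²`
  have key := flowTime_iterate_ge hC hv₀C (tau_pos t).le (8 ^ t)
  rw [Nat.cast_pow, Nat.cast_ofNat, Real.sqrt_sq hv₀0.le] at key
  have h8 : (0 : ℝ) < 8 ^ t := by positivity
  have htau : tau t = 7 / 8 ^ t := rfl
  have hsum : (8 : ℝ) ^ t * (tau t - lam * tau t ^ 2) = 7 - 49 * lam / 8 ^ t := by
    rw [htau]; field_simp; ring
  set xN := (eStep C (tau t))^[8 ^ t] (v₀ ^ 2) with hxN
  have hxN0 : v₀ ^ 2 ≤ xN := le_iterate_eStep hC (tau_pos t).le (pow_le_pow_left₀ hC.le hv₀C.le 2) _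
  have htime : 7 - 49 * lam / 8 ^ t ≤ flowTime C (Real.sqrt xN) - flowTime C v₀ := by
    rw [hlam] at hsum ⊢; rw [← hsum]; exact key
  -- the Euler deficit fits in the budget
  have hdef : 49 * lam / 8 ^ t ≤ 49 * C ^ 2 / (1296 * 8 ^ n) := by
    have hl := lam_le hC hv₀ge
    rw [← hlam] at hl
    have hC2 : 0 < C ^ 2 := by positivity
    have hC4 : 0 < C ^ 4 := by positivity
    have h8n : (0 : ℝ) < 8 ^ n := by positivity
    have h8t₀ : (0 : ℝ) < 8 ^ t₀ := by positivity
    have e : (8 : ℝ) ^ t = 8 ^ t₀ * 8 ^ n := by rw [htdef, pow_add]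
    rw [e, div_le_div_iff₀ (by positivity) (by positivity)]
    -- `49·lam·1296·8^n ≤ 49C²·8^{t₀}·8^n` from `lam ≤ 108∕(343C²)` and `343C⁴·8^{t₀} ≥ 139968 = 108·1296`
    have h1 : lam * (343 * C ^ 2) ≤ 108 := by
      have := mul_le_mul_of_nonneg_right hl (show (0 : ℝ) ≤ 343 * C ^ 2 by positivity)
      rwa [div_mul_cancel₀ _ (by positivity : (343 : ℝ) * C ^ 2 ≠ 0)] at this
    have h2 : 139968 ≤ 343 * C ^ 4 * 8 ^ t₀ := by
      have := mul_le_mul_of_nonneg_left ht₀ (show (0 : ℝ) ≤ 343 * C ^ 4 by positivity)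
      rwa [mul_div_cancel₀ _ (by positivity : (343 : ℝ) * C ^ 4 ≠ 0)] at this
    have h3 : lam * 1296 * (343 * C ^ 4) ≤ 108 * 1296 * C ^ 2 := by nlinarith [h1, hC2]
    nlinarith [h2, h3, h8n, mul_le_mul_of_nonneg_right h3 h8n.le, hlam0]
  have hbudget := chain_budget_ge C n
  rw [← hsdef, ← hs'def] at hbudget
  have hε : 12 * C ^ 2 * s ^ 2 + 49 * lam / 8 ^ t ≤ 14 / 3 * C ^ 2 * (s - s') := by linarith
  -- one link
  have hlink := chain_link hC hCψ hs'0 hss' hs3 (x := xN) (ε := 49 * lam / 8 ^ t) (by rw [← hv₀def]; exact hxN0)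
    (by rw [← hv₀def]; exact htime) hε
  -- `σ_{n+1} = w′²∕4 ≤ xN∕4 = S_t C σ_n`
  show (C * (7 / 3 + s') / 2) ^ 2 ≤ S t C (v₀ ^ 2)
  unfold S
  rw [← hxN]
  nlinarith [hlink]

/-! ## §5 The critical value is impossible -/

/-- **THE OCTAL STAIRCASE IS IMPOSSIBLE ON THE LINEAR ROAD FOR EVERY `0 < C ≤ cStarConj = √(84∕(77 + 72·log 2))`** (every box `γ₀ > 0`) — the
closed lower half, INCLUDING the critical value, by the chain criterion at full resolution. [cite: Balaban1987RG1, Thm 2 p.259 (first sentence) and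
(2.12)–(2.14) p.268] -/
theorem not_endPossibleLin_bOct_of_le_cStarConj {C γ₀ : ℝ} (hC : 0 < C) (hle : C ≤ cStarConj) (hγ₀ : 0 < γ₀) :
    ¬ EndPossibleLin bOct C γ₀ := by
  have hCψ : C ^ 2 * psi (7 / 3) ≤ 7 := (le_cStarConj_iff hC).mp hle
  obtain ⟨t₀, ht₀⟩ := pow_unbounded_of_one_lt (139968 / (343 * C ^ 4)) (by norm_num : (1 : ℝ) < 8)
  refine not_endPossibleLin_bOct_of_chain hC t₀ (σ := fun n => (C * (7 / 3 + 7 / (36 * ((n : ℝ) + 2))) / 2) ^ 2)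
    (fun n => ?_) (fun n => chain_holds hC hCψ ht₀.le n) hγ₀
  have hn : (0 : ℝ) ≤ n := n.cast_nonneg
  have hs : (0 : ℝ) ≤ 7 / (36 * ((n : ℝ) + 2)) := by positivity
  have h76 : C ≤ C * (7 / 3 + 7 / (36 * ((n : ℝ) + 2))) / 2 := by nlinarith
  exact pow_le_pow_left₀ hC.le h76 2

/-- **THE CRITICAL VALUE ITSELF IS IMPOSSIBLE: `¬ EndPossibleLin bOct cStarConj γ₀`** — GEN 10's threshold `C⋆(bOct) = cStarConj` (X18 ∕ X19) is
NOT attained from the possible side. [cite: Balaban1987RG1, Thm 2 p.259 (first sentence) and (2.12)–(2.14) p.268] -/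
theorem not_endPossibleLin_bOct_cStarConj {γ₀ : ℝ} (hγ₀ : 0 < γ₀) : ¬ EndPossibleLin bOct cStarConj γ₀ :=
  not_endPossibleLin_bOct_of_le_cStarConj cStarConj_pos le_rfl hγ₀

/-- Contrapositive reading: possibility of the octal staircase on the linear road with a constant `C > 0` forces `C > cStarConj`. [folklore] -/
theorem cStarConj_lt_of_endPossibleLin {C γ₀ : ℝ} (hC : 0 < C) (hγ₀ : 0 < γ₀) (h : EndPossibleLin bOct C γ₀) : cStarConj < C :=
  lt_of_not_ge fun hle => not_endPossibleLin_bOct_of_le_cStarConj hC hle hγ₀ h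

/-! ## §6 (v1.1, append-only) The criterion in terms of the tangential doubling time -/

/-- **`C²·ψ(7∕3) ≤ 7 ⟹ ¬ EndPossibleLin bOct C γ₀`** (`0 < C`, `γ₀ > 0`) — the closed lower half stated through the tangential doubling time
`C²ψ(7∕3) = C²(77∕12 + 6 log 2)` of X16 rather than through the square-root constant (`le_cStarConj_iff`). [folklore] -/
theorem not_endPossibleLin_bOct_of_sq_mul_psiMin_le {C γ₀ : ℝ} (hC : 0 < C) (h : C ^ 2 * psi (7 / 3) ≤ 7) (hγ₀ : 0 < γ₀) :
    ¬ EndPossibleLin bOct C γ₀ :=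
  not_endPossibleLin_bOct_of_le_cStarConj hC ((le_cStarConj_iff hC).mpr h) hγ₀

end

end Summit.QuantumFields.BalabanUV.Gaps.EndDrawdownLinearThresholdCritical
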